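import Summits.ResolutionOfSingularities.ResolutionOfSingularities.Theorems.UniversalCellsLocalToGlobalHSTowerDefs
import Mathlib.AlgebraicGeometry.Morphisms.Proper
import HarnessLib

/-!
# `LocalToGlobal` (crux stmt-ResolutionOfSingularities-15232, route UniversalCells), line `Sketch`
# (idea `existence-certified-termination`) — stub `stub_isOpen_resolvedOver`

Helper file (`--supports stmt-ResolutionOfSingularities-15232`; does not close the item).
Objects: `Theorems/UniversalCellsLocalToGlobalHSTowerDefs.lean` (the blind lex-maximal
Hilbert–Samuel tower: `hsCentre`, `hsStep`, `NormalVariety.step`, `stepπ`, `iterπ`, `IsResolvedOver`).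

Statement (`stub_isOpen_resolvedOver`): for a normal variety `V` over a field `k`, a level `N`
and a stage `n`, the resolved-over locus `{x : V | V.IsResolvedOver N n x}` ("every point of
`V_n = (step N)^[n] V` above `x` has a regular local ring") is open in `V`. Proof: with
`π = NormalVariety.iterπ N n V : V_n → V`, this set is the complement of
`π '' (V_n ∖ Reg V_n)` (pure logic, `setOf_isResolvedOver_eq`).
`Reg V_n = Scheme.regularLocus V_n.X` is open because `V_n` is locally of finite type over the
field `k` (`isOpen_regularLocus_of_locallyOfFiniteType_field V_n.hom`, Matsumura Cor. to
Thm. 30.5), so `V_n ∖ Reg V_n` is closed; `π` is proper (`isProper_iterπ`, induction on `n` from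
the instance `NormalVariety.isProper_stepπ` and the definitional `iterπ_zero` / `iterπ_succ`),
hence universally closed, hence a closed map on points (Mathlib `Scheme.Hom.isClosedMap`), so
the image is closed and its complement is open.
-/

set_option linter.dupNamespace false -- mandated namespace of this single-conjunct summit

noncomputable section

open CategoryTheory AlgebraicGeometry TopologicalSpace Topology
open AlgebraicGeometry.Scheme.IdealSheafData
open Literature.AlgebraicGeometry.Resolution

namespace Summit.ResolutionOfSingularities.ResolutionOfSingularities.Theorems.LocalToGlobal.HSTower

/-! ## The tower maps are proper -/

/-- The tower map `V_n → V` is proper: by induction on `n`, it is the identity for `n = 0` and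
the composite `V_{n+1} → V_1 → V` of a tower map of `V_1` with the proper step `V_1 → V`
(`NormalVariety.isProper_stepπ`) for `n + 1`. [folklore] -/
private theorem isProper_iterπ {k : Type*} [Field k] (N : ℕ) :
    ∀ (n : ℕ) (V : NormalVariety k), IsProper (NormalVariety.iterπ N n V)
  | 0, V => show IsProper (𝟙 V.X) from inferInstance
  | n + 1, V =>
    haveI := isProper_iterπ N n (V.step N)
    show IsProper (NormalVariety.iterπ N n (V.step N) ≫ V.stepπ N) from inferInstance

/-- The resolved-over locus of stage `n` is the complement of the image of the singular locus
`V_n ∖ Reg V_n` under the tower map `V_n → V` (pure logic). [folklore] -/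
private theorem setOf_isResolvedOver_eq {k : Type*} [Field k] (V : NormalVariety k) (N n : ℕ) :
    {x : V.X | V.IsResolvedOver N n x} =
      ((NormalVariety.iterπ N n V).base ''
        (Scheme.regularLocus ((NormalVariety.step N)^[n] V).X)ᶜ)ᶜ := by
  ext x
  constructor
  · rintro h ⟨y, hy, hyx⟩
    exact hy (h y hyx)
  · intro h y hyx
    by_contra hy
    exact h ⟨y, hy, hyx⟩

/-! ## The stub -/

/-- **Stub `stub_isOpen_resolvedOver` of line `Sketch` — (the resolved-over locus of a stage is open).** `{x | V_n is regular over x}` is the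
complement of the image of `Sing V_n` (closed: `V_n` is locally of finite type over `k`) under
the proper, hence closed, map `V_n → V`. [folklore] -/
theorem stub_isOpen_resolvedOver (k : Type) [Field k] (V : NormalVariety k) (N n : ℕ) :
    IsOpen {x : V.X | V.IsResolvedOver N n x} := by
  haveI := isProper_iterπ N n V
  rw [setOf_isResolvedOver_eq]
  exact ((NormalVariety.iterπ N n V).isClosedMap _
    (isOpen_regularLocus_of_locallyOfFiniteType_field
      ((NormalVariety.step N)^[n] V).hom).isClosed_compl).isOpen_compl

end Summit.ResolutionOfSingularities.ResolutionOfSingularities.Theorems.LocalToGlobal.HSTower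

end
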